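import Summits.Ventures.MM22.Rank333.ProfileSATCounter

/-!
# MM22 venture — `ProfileSAT` (4/4): instances «exactly `k` of `n` with row caps» and the verified encoder

HONEST FRAMING (cell `pub-mm22`, seat engine-2 g3). `Inst.encode` (cardinality block + one block per row) and
`Inst.encode_complete` (a solution extends to a model of the CNF); with the kernel LRAT bridge of `ProfileSAT.lean` this gives
`Inst.not_sol_of_propUnsat`: a refuted encoding means the instance has no solution. The dictionary «instance ↔ sub-case of the
M2-split of the root profile question for ⟨3,3,3⟩ over 𝔽₂» lives in the data files; no rank bound is proved here.
-/

namespace Summit.Ventures.MM22.ProfileSAT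

/-! ## 8. Instances «exactly `k` of `n`, row caps» and the verified encoder -/

/-- An instance: variables `0 … n-1`, exactly `k` of them true, and rows `(members, cap)` demanding that at most
`cap` of the listed variables are true. -/
structure Inst where
  /-- number of (primary) variables -/
  n : ℕ
  /-- required number of true variables -/
  k : ℕ
  /-- rows `(members, cap)` -/
  rows : List (List ℕ × ℕ)

/-- `x` solves the instance. -/
def Inst.Sol (I : Inst) (x : ℕ → Bool) : Prop :=
  cnt x (List.range I.n) = I.k ∧ ∀ r ∈ I.rows, cnt x r.1 ≤ r.2

/-- Well-formedness: at least one variable, and rows mention only variables `< n`. -/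
def Inst.wf (I : Inst) : Prop := 0 < I.n ∧ ∀ r ∈ I.rows, ∀ m ∈ r.1, m < I.n

/-- Well-formedness is decidable (checked by `decide` in the data files). -/
instance (I : Inst) : Decidable I.wf :=
  inferInstanceAs (Decidable (0 < I.n ∧ ∀ r ∈ I.rows, ∀ m ∈ r.1, m < I.n))

/-- Cheap binomial coefficient `C(p, c)` (multiplicative formula; only used to pick an encoding). -/
def binomIter (p c : ℕ) : ℕ :=
  (List.range c).foldl (fun b t => b * (p - c + t + 1) / (t + 1)) 1

/-- Rows with at most this many direct no-goods are encoded directly, larger ones by a counter. -/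
def directLimit : ℕ := 400

/-- Encoding of one row at current variable count `nv`: returns the new variable count and the clauses. -/
def rowBlock (nv : ℕ) (members : List ℕ) (cap : ℕ) : ℕ × CNF :=
  if members.length ≤ cap then (nv, [])
  else if binomIter members.length (cap + 1) ≤ directLimit then (nv, nogoods members cap)
  else (nv + members.length * (cap + 1),
    collect (counterClauses nv (cap + 1) members ++ [[sN nv (cap + 1) members.length (cap + 1)]]))

/-- Encoding of «exactly `k` of the variables `0 … n-1`»: a counter with `k+1` thresholds based at `n`. -/
def cardBlock (n k : ℕ) : ℕ × CNF :=
  (n + n * (k + 1),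
    collect (counterClauses n (k + 1) (List.range n) ++ [[sP n (k + 1) n k], [sN n (k + 1) n (k + 1)]]))

/-- Encoding of the rows in order, threading the variable count. -/
def encodeRows : ℕ → List (List ℕ × ℕ) → ℕ × List CNF
  | nv, [] => (nv, [])
  | nv, r :: rs =>
    match rowBlock nv r.1 r.2 with
    | (nv1, cs) =>
      match encodeRows nv1 rs with
      | (nv2, css) => (nv2, cs :: css)

/-- **The encoder**: number of variables and clause list (cardinality block first, then the rows). -/
def Inst.encode (I : Inst) : ℕ × CNF :=
  match cardBlock I.n I.k with
  | (nv1, cs) =>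
    match encodeRows nv1 I.rows with
    | (nv2, css) => (nv2, cs ++ css.flatten)

/-- Counts agree for assignments that agree on the listed variables. -/
theorem cnt_congr {x y : ℕ → Bool} {l : List ℕ} (h : ∀ m ∈ l, y m = x m) : cnt y l = cnt x l :=
  List.countP_congr fun m hm => by simp [h m hm]

/-- `collect` distributes over concatenation. -/
theorem collect_append (a b : List (List ELit)) : collect (a ++ b) = collect a ++ collect b := by
  induction a with
  | nil => rfl
  | cons e es ih =>
    simp only [List.cons_append, collect]
    cases EClause.toClause e <;> simp [ih]

/-- Variables of collected clauses come from the extended clauses. -/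
theorem collect_vars {L : List (List ELit)} {P : ℕ → Prop}
    (h : ∀ e ∈ L, ∀ l : Lit, ELit.lit l ∈ e → P l.var) : ∀ c ∈ collect L, ∀ l ∈ c, P l.var := by
  intro c hc l hl
  obtain ⟨e, he, hec⟩ := mem_collect hc
  exact h e he l (EClause.toClause_vars hec l hl)

/-- The full prefix count is the count. -/
theorem prefixCnt_length (x : ℕ → Bool) (members : List ℕ) :
    prefixCnt x members members.length = cnt x members := by
  simp [prefixCnt, List.take_length]

/-- **Row block soundness.** -/
theorem rowBlock_sound {n nv : ℕ} {members : List ℕ} {cap : ℕ} (hmem : ∀ m ∈ members, m < n) (hn : n ≤ nv)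
    (y : ℕ → Bool) (hy : cnt y members ≤ cap) :
    nv ≤ (rowBlock nv members cap).1 ∧
    (∀ c ∈ (rowBlock nv members cap).2, ∀ l ∈ c, l.var < (rowBlock nv members cap).1) ∧
    ∃ y' : ℕ → Bool, (∀ v < nv, y' v = y v) ∧ ∀ c ∈ (rowBlock nv members cap).2, c.eval y' = true := by
  unfold rowBlock
  by_cases h1 : members.length ≤ cap
  · rw [if_pos h1]
    exact ⟨le_rfl, by simp, y, fun _ _ => rfl, by simp⟩
  · rw [if_neg h1]
    by_cases h2 : binomIter members.length (cap + 1) ≤ directLimit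
    · rw [if_pos h2]
      refine ⟨le_rfl, fun c hc l hl => ?_, y, fun _ _ => rfl, nogoods_sound hy⟩
      have := hmem _ (nogoods_vars c hc l hl)
      simp only; omega
    · rw [if_neg h2]
      simp only
      refine ⟨by omega, ?_, ?_⟩
      · refine collect_vars (P := fun v => v < nv + members.length * (cap + 1)) ?_
        intro e he l hl
        rcases List.mem_append.1 he with he | he
        · rcases counterClauses_vars rfl e he l hl with h | h
          · have := hmem _ h; omega
          · exact h.2
        · simp only [List.mem_singleton] at he
          subst he
          simp only [List.mem_singleton] at hl
          exact (var_of_sN le_rfl le_rfl hl).2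
      · refine ⟨extend y nv (members.length * (cap + 1)) (canon y members (cap + 1)),
          fun v hv => extend_of_lt hv, ?_⟩
        apply collect_sound
        intro e he
        rcases List.mem_append.1 he with he | he
        · exact counterClauses_sound rfl (fun m hm => by have := hmem m hm; omega) (fun _ _ => rfl) e he
        · simp only [List.mem_singleton] at he
          subst he
          simp only [List.any_cons, List.any_nil, Bool.or_false]
          rw [eval_sN members.length (cap + 1) le_rfl le_rfl, prefixCnt_length]
          simpa using Nat.lt_succ_of_le hy

/-- **Cardinality block soundness.** -/
theorem cardBlock_sound (n k : ℕ) (y : ℕ → Bool) (hy : cnt y (List.range n) = k) :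
    n ≤ (cardBlock n k).1 ∧
    (∀ c ∈ (cardBlock n k).2, ∀ l ∈ c, l.var < (cardBlock n k).1) ∧
    ∃ y' : ℕ → Bool, (∀ v < n, y' v = y v) ∧ ∀ c ∈ (cardBlock n k).2, c.eval y' = true := by
  unfold cardBlock
  simp only
  have hlen : (List.range n).length = n := List.length_range
  refine ⟨by omega, ?_, ?_⟩
  · refine collect_vars (P := fun v => v < n + n * (k + 1)) ?_
    intro e he l hl
    rcases List.mem_append.1 he with he | he
    · rcases counterClauses_vars hlen e he l hl with h | h
      · have := List.mem_range.1 h; omega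
      · exact h.2
    · simp only [List.mem_cons, List.not_mem_nil, or_false] at he
      rcases he with rfl | rfl
      · simp only [List.mem_singleton] at hl
        exact (var_of_sP (p := n) le_rfl (Nat.le_succ k) hl).2
      · simp only [List.mem_singleton] at hl
        exact (var_of_sN (p := n) le_rfl le_rfl hl).2
  · refine ⟨extend y n (n * (k + 1)) (canon y (List.range n) (k + 1)), fun v hv => extend_of_lt hv, ?_⟩
    apply collect_sound
    intro e he
    rcases List.mem_append.1 he with he | he
    · exact counterClauses_sound hlen (fun m hm => List.mem_range.1 hm) (fun _ _ => rfl) e he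
    · have hfull : prefixCnt y (List.range n) n = k := by
        rw [← hy, ← prefixCnt_length, hlen]
      simp only [List.mem_cons, List.not_mem_nil, or_false] at he
      rcases he with rfl | rfl
      · simp only [List.any_cons, List.any_nil, Bool.or_false]
        rw [eval_sP (p := n) n k le_rfl (Nat.le_succ k), hfull]
        simp
      · simp only [List.any_cons, List.any_nil, Bool.or_false]
        rw [eval_sN (p := n) n (k + 1) le_rfl le_rfl, hfull]
        simp

/-- **Rows soundness** (induction over the rows, threading the assignment). -/
theorem encodeRows_sound (x : ℕ → Bool) (n : ℕ) :
    ∀ (rows : List (List ℕ × ℕ)) (nv : ℕ) (y : ℕ → Bool), n ≤ nv →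
      (∀ r ∈ rows, (∀ m ∈ r.1, m < n) ∧ cnt x r.1 ≤ r.2) → (∀ v < n, y v = x v) →
      nv ≤ (encodeRows nv rows).1 ∧
      ∃ y' : ℕ → Bool, (∀ v < nv, y' v = y v) ∧ ∀ c ∈ (encodeRows nv rows).2.flatten, c.eval y' = true
  | [], nv, y, _, _, _ => ⟨le_rfl, y, fun _ _ => rfl, by simp [encodeRows]⟩
  | r :: rs, nv, y, hn, hrows, hyx => by
    have hr := hrows r List.mem_cons_self
    have hcnt : cnt y r.1 ≤ r.2 := by
      rw [cnt_congr fun m hm => hyx m (hr.1 m hm)]; exact hr.2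
    obtain ⟨hle1, hvars1, y1, hy1, hsat1⟩ := rowBlock_sound (nv := nv) hr.1 hn y hcnt
    have hyx1 : ∀ v < n, y1 v = x v := fun v hv => by rw [hy1 v (by omega), hyx v hv]
    obtain ⟨hle2, y2, hy2, hsat2⟩ := encodeRows_sound x n rs (rowBlock nv r.1 r.2).1 y1 (by omega)
      (fun r' hr' => hrows r' (List.mem_cons_of_mem _ hr')) hyx1
    rcases e1 : rowBlock nv r.1 r.2 with ⟨nv1, cs⟩
    rw [e1] at hle1 hvars1 hsat1 hle2 hy2 hsat2
    simp only at hle1 hvars1 hsat1 hle2 hy2 hsat2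
    rcases e2 : encodeRows nv1 rs with ⟨nv2, css⟩
    rw [e2] at hle2 hsat2
    simp only at hle2 hsat2
    simp only [encodeRows, e1, e2]
    refine ⟨by omega, y2, fun v hv => by rw [hy2 v (by omega), hy1 v hv], ?_⟩
    intro c hc
    simp only [List.flatten_cons, List.mem_append] at hc
    rcases hc with hc | hc
    · rw [← hsat1 c hc]
      exact Clause.eval_congr fun l hl => hy2 l.var (hvars1 c hc l hl)
    · exact hsat2 c hc

/-- **Completeness of the encoder**: a solution of a well-formed instance yields a model of its CNF. -/
theorem Inst.encode_complete (I : Inst) (hwf : I.wf) (x : ℕ → Bool) (hx : I.Sol x) :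
    ∃ y : ℕ → Bool, (I.encode).2.eval y = true := by
  obtain ⟨hle0, hvars0, y1, hy1, hsat1⟩ := cardBlock_sound I.n I.k x hx.1
  obtain ⟨_, y2, hy2, hsat2⟩ := encodeRows_sound x I.n I.rows (cardBlock I.n I.k).1 y1 hle0
    (fun r hr => ⟨hwf.2 r hr, hx.2 r hr⟩) (fun v hv => hy1 v hv)
  refine ⟨y2, ?_⟩
  rcases e1 : cardBlock I.n I.k with ⟨nv1, cs⟩
  rw [e1] at hvars0 hsat1 hy2 hsat2
  simp only at hvars0 hsat1 hy2 hsat2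
  rcases e2 : encodeRows nv1 I.rows with ⟨nv2, css⟩
  rw [e2] at hsat2
  simp only at hsat2
  simp only [Inst.encode, e1, e2, CNF.eval, List.all_eq_true, List.mem_append]
  intro c hc
  rcases hc with hc | hc
  · rw [← hsat1 c hc]
    exact Clause.eval_congr fun l hl => hy2 l.var (hvars0 c hc l hl)
  · exact hsat2 c hc

/-- The encoded CNF is never empty (it contains the unit `¬s_{n,k+1}` of the cardinality block). -/
theorem Inst.encode_ne_nil (I : Inst) (hwf : I.wf) : (I.encode).2 ≠ [] := by
  rcases e1 : cardBlock I.n I.k with ⟨nv1, cs⟩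
  rcases e2 : encodeRows nv1 I.rows with ⟨nv2, css⟩
  simp only [Inst.encode, e1, e2]
  have hcs : cs ≠ [] := by
    have : cs = (cardBlock I.n I.k).2 := by rw [e1]
    rw [this]
    unfold cardBlock
    simp only [collect_append]
    have hn : I.n ≠ 0 := Nat.pos_iff_ne_zero.1 hwf.1
    have h2 : collect [[sP I.n (I.k + 1) I.n I.k], [sN I.n (I.k + 1) I.n (I.k + 1)]] ≠ [] := by
      simp [collect, sP, sN, hn, EClause.toClause]
      split <;> simp
    exact fun h => h2 (List.append_eq_nil_iff.1 h).2
  exact fun h => hcs (List.append_eq_nil_iff.1 h).1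

/-- **Main theorem of this file.** If the balanced clause tree of the encoding of a well-formed instance is
refuted in the `lrat_proof` shape, the instance has no solution. -/
theorem Inst.not_sol_of_propUnsat (I : Inst) (hwf : I.wf) (h : (CT.ofList (I.encode).2).PropUnsat)
    (x : ℕ → Bool) : ¬ I.Sol x := by
  intro hx
  obtain ⟨y, hy⟩ := I.encode_complete hwf x hx
  have := CT.eval_false_of_propUnsat h y
  rw [CT.toList_ofList _ (I.encode_ne_nil hwf), hy] at this
  exact Bool.noConfusion this

end Summit.Ventures.MM22.ProfileSAT
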